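import Mathlib
import Summits.Ventures.HodgeRepro.Tier4.Target
import Summits.Ventures.HodgeRepro.Tier4.Line3.Defs
import Summits.Ventures.HodgeRepro.Tier4.Line3.DefsLemmas
import Summits.Ventures.HodgeRepro.Tier4.Line3.GaussRatioFormula
import Summits.Ventures.HodgeRepro.Tier4.Line3.CopyWeightGaussian
import Summits.Ventures.HodgeRepro.Tier4.Line3.QuarticProfile
import Summits.Ventures.HodgeRepro.Tier4.Line3.RatioWindow
import Summits.Ventures.HodgeRepro.Tier4.Line3.WindowCentre
import Summits.Ventures.HodgeRepro.Tier4.Line3.QuarticNormOne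

/-!
# Tier4/Line3/ScalarHodd — the non-boundary clause of the quartic window display is reached by a common scalar

Blind re-derivation cell `pub-hodge-repro`, Tier 4 «PROVE THE STEP», LINE L3, seat t4-L3-p2 (g3): C-L3-HODD (offer S14587).
The display `IsHeckeLocalisablePrintRayQW` (skeleton v0.55 II-ae) carries the clause `hodd`: «no slot ratio
`2 q_σ(xm j)/h(xm j)` of the base centre is an odd power of `η₀`» — necessary for unit scalings (a unit power moves a ratio by
`η₀^(−2k)`, WindowCentre `ratio_zpow_smul`). A COMMON scalar `λ` on the four slots (symmetry and the four centre clauses kept,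
WindowCentre `wedge_scaled_ne` / `jpos_scaled` / `gram_scaled_ne`) multiplies every ratio by `ρ(λ) = ‖σ₁ λ‖²/‖τ₀ λ‖²`:

* in the window `ρ ∈ (1/η₀, η₀)` each ratio `r` has AT MOST ONE bad factor `ρ` (`ρ r ∈ η₀^(2ℤ+1)`): two such differ by an
  even power of `η₀` inside `(η₀⁻², η₀²)` (`eq_of_mul_eq_zpow_odd`);
* with `λ_n = n + b` (`b` with `τ₀ b ∉ {σ₁ b, conj (σ₁ b)}`, QuarticNormOne `exists_b_ne`) the factors
  `ρ_n = ‖n + σ₁ b‖²/‖n + τ₀ b‖² → 1` (`tendsto_ratio`) lie in the window for `n` large, and a value is taken at most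
  twice (`ratio_eq_at_most_two`: the ratio is a non-constant rational function of degree `≤ 2`);
* pigeonhole on `9` consecutive `n` against the `4` slots: some `λ_n` is bad for no slot — `exists_scalar_hodd`.

Nothing here says anything about the status of the Hodge conjecture for CM abelian varieties, which is NOT proved
(HC_CM is NOT proved by anyone in this repository).
-/

set_option autoImplicit false

noncomputable section

namespace Summit.Ventures.HodgeRepro.Tier4.Line3

open Summit.Ventures.HodgeRepro.Tier4
open Matrix NumberField Filter Topology
open scoped ComplexConjugate
open scoped Classical

/-! ## A. Real lemmas -/

/-- Equal real parts and equal moduli: `z₁ ∈ {z₂, conj z₂}`. -/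
theorem eq_or_eq_conj_of_re_norm {z₁ z₂ : ℂ} (hre : z₁.re = z₂.re) (hsq : ‖z₁‖ ^ 2 = ‖z₂‖ ^ 2) :
    z₁ = z₂ ∨ z₁ = conj z₂ := by
  rw [Complex.sq_norm, Complex.sq_norm, Complex.normSq_apply, Complex.normSq_apply, hre] at hsq
  have him : z₁.im ^ 2 = z₂.im ^ 2 := by nlinarith
  rcases sq_eq_sq_iff_eq_or_eq_neg.1 him with h | h
  · exact Or.inl (Complex.ext hre h)
  · exact Or.inr (Complex.ext (by rw [Complex.conj_re]; exact hre) (by rw [Complex.conj_im]; exact h))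

/-- **A RATIO VALUE IS TAKEN AT MOST TWICE**: three distinct indices with the same ratio force `z₁ ∈ {z₂, conj z₂}`. -/
theorem ratio_eq_at_most_two {z₁ z₂ : ℂ} (h1 : z₁ ≠ z₂) (h2 : z₁ ≠ conj z₂) {n m l : ℕ}
    (hnm : n ≠ m) (hnl : n ≠ l) (hml : m ≠ l)
    (hn : ‖(n : ℂ) + z₂‖ ≠ 0) (hm : ‖(m : ℂ) + z₂‖ ≠ 0) (hl : ‖(l : ℂ) + z₂‖ ≠ 0) {R : ℝ}
    (en : ‖(n : ℂ) + z₁‖ ^ 2 / ‖(n : ℂ) + z₂‖ ^ 2 = R)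
    (em : ‖(m : ℂ) + z₁‖ ^ 2 / ‖(m : ℂ) + z₂‖ ^ 2 = R)
    (el : ‖(l : ℂ) + z₁‖ ^ 2 / ‖(l : ℂ) + z₂‖ ^ 2 = R) : False := by
  rw [div_eq_iff (pow_ne_zero 2 hn), norm_natCast_add_sq, norm_natCast_add_sq] at en
  rw [div_eq_iff (pow_ne_zero 2 hm), norm_natCast_add_sq, norm_natCast_add_sq] at em
  rw [div_eq_iff (pow_ne_zero 2 hl), norm_natCast_add_sq, norm_natCast_add_sq] at el
  have hnm' : (n : ℝ) ≠ m := by exact_mod_cast hnm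
  have hnl' : (n : ℝ) ≠ l := by exact_mod_cast hnl
  have hml' : (m : ℝ) ≠ l := by exact_mod_cast hml
  have e1 : ((n : ℝ) - m) * ((1 - R) * ((n : ℝ) + m) + 2 * (z₁.re - R * z₂.re)) = 0 := by
    linear_combination en - em
  have e2 : ((n : ℝ) - l) * ((1 - R) * ((n : ℝ) + l) + 2 * (z₁.re - R * z₂.re)) = 0 := by
    linear_combination en - el
  have e1' := (mul_eq_zero.1 e1).resolve_left (sub_ne_zero.2 hnm')
  have e2' := (mul_eq_zero.1 e2).resolve_left (sub_ne_zero.2 hnl')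
  have e3 : (1 - R) * ((m : ℝ) - l) = 0 := by linear_combination e1' - e2'
  have hA : 1 - R = 0 := (mul_eq_zero.1 e3).resolve_right (sub_ne_zero.2 hml')
  have hR : R = 1 := by linarith
  subst hR
  have hre : z₁.re = z₂.re := by linarith
  have hsq : ‖z₁‖ ^ 2 = ‖z₂‖ ^ 2 := by nlinarith
  rcases eq_or_eq_conj_of_re_norm hre hsq with h | h
  · exact h1 h
  · exact h2 h

/-- **AT MOST ONE BAD FACTOR IN THE WINDOW**: if `ρ r` and `ρ' r` are odd powers of `η₀` with `ρ, ρ' ∈ (1/η₀, η₀)`, then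
`ρ = ρ'` (their quotient is an even power of `η₀` in `(η₀⁻², η₀²)`). -/
theorem eq_of_mul_eq_zpow_odd {η₀ r ρ ρ' : ℝ} (hη : 1 < η₀) (hr : 0 < r)
    (hρ1 : 1 / η₀ < ρ) (hρ2 : ρ < η₀) (hρ1' : 1 / η₀ < ρ') (hρ2' : ρ' < η₀) {k k' : ℤ}
    (hk : ρ * r = η₀ ^ (2 * k + 1)) (hk' : ρ' * r = η₀ ^ (2 * k' + 1)) : ρ = ρ' := by
  have hη0 : 0 < η₀ := by linarith
  have hinv : 0 < 1 / η₀ := by positivity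
  have hρ0 : 0 < ρ := lt_trans hinv hρ1
  have hρ0' : 0 < ρ' := lt_trans hinv hρ1'
  have hdiv : ρ / ρ' = η₀ ^ (2 * (k - k')) := by
    have e : ρ / ρ' = (ρ * r) / (ρ' * r) := by
      rw [mul_div_mul_right _ _ hr.ne']
    rw [e, hk, hk', ← zpow_sub₀ hη0.ne']
    congr 1
    ring
  have hρ1'' : 1 < η₀ * ρ' := by
    rw [div_lt_iff₀ hη0] at hρ1'
    linarith
  have hρ1''' : 1 < η₀ * ρ := by
    rw [div_lt_iff₀ hη0] at hρ1
    linarith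
  have hlt : ρ / ρ' < η₀ ^ (2 : ℤ) := by
    rw [div_lt_iff₀ hρ0', _root_.zpow_two]
    nlinarith
  have hgt : η₀ ^ (-2 : ℤ) < ρ / ρ' := by
    rw [lt_div_iff₀ hρ0', _root_.zpow_neg, _root_.zpow_two, inv_mul_lt_iff₀ (by positivity)]
    nlinarith
  rw [hdiv] at hlt hgt
  have h1 := (zpow_lt_zpow_iff_right₀ hη).1 hlt
  have h2 := (zpow_lt_zpow_iff_right₀ hη).1 hgt
  have hkk : k = k' := by omega
  subst hkk
  exact mul_right_cancel₀ hr.ne' (hk.trans hk'.symm)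

namespace T4Data

variable (X : T4Data)

/-! ## B. The scalar -/

/-- The ratio of a scaled slot at a definite embedding: the common factor `‖σ₁ λ‖²/‖τ₀ λ‖²` times the ratio at `σ₁`
(`ratio_smul`, `defQuad_conjEmb`, `norm_conjEmb_apply`). -/
theorem ratio_smul_defEmb {σ₁ : X.E →+* ℂ} (hdef : X.defEmb = {σ₁, conjEmb σ₁}) {lam : X.E} (hlam : lam ≠ 0)
    {x : Fin 3 → X.E} (hx : x ≠ 0) {σ : X.E →+* ℂ} (hσ : σ ∈ X.defEmb) :
    2 * X.defQuad σ (lam • x) / X.tauSize (lam • x) =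
      (‖σ₁ lam‖ ^ 2 / ‖X.τ₀ lam‖ ^ 2) * (2 * X.defQuad σ₁ x / X.tauSize x) := by
  rw [X.ratio_smul σ hlam x hx]
  rw [hdef, Finset.mem_insert, Finset.mem_singleton] at hσ
  rcases hσ with rfl | rfl
  · rfl
  · rw [X.norm_conjEmb_apply, X.defQuad_conjEmb]

/-- **C-L3-HODD**: on a quartic CM field, for every `η₀ > 1` and every centre with non-zero slots there is a common scalar
`λ ≠ 0` such that no slot ratio of `λ • xm` at a definite embedding is an odd power of `η₀`. -/
theorem exists_scalar_hodd (hQ : X.QuarticShape) {η₀ : ℝ} (hη : 1 < η₀) {xm : X.Tuple} (hx : ∀ j, xm j ≠ 0) :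
    ∃ lam : X.E, lam ≠ 0 ∧ ∀ j, ∀ σ ∈ X.defEmb, ∀ k : ℤ,
      2 * X.defQuad σ (lam • xm j) / X.tauSize (lam • xm j) ≠ η₀ ^ (2 * k + 1) := by
  obtain ⟨σ₁, hσ, hdef⟩ := hQ
  have hσ₁ : σ₁ ∈ X.defEmb := by rw [hdef]; exact Finset.mem_insert_self _ _
  obtain ⟨b, hb1, hb2⟩ := X.exists_b_ne hσ₁
  have hb1' : σ₁ b ≠ X.τ₀ b := hb1.symm
  have hb2' : σ₁ b ≠ conj (X.τ₀ b) := by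
    intro h
    apply hb2
    rw [h, Complex.conj_conj]
  have hη0 : 0 < η₀ := by linarith
  -- the factors `ρ n = ‖n + σ₁ b‖² / ‖n + τ₀ b‖²` tend to `1`
  have hε : 0 < min (η₀ - 1) (1 - 1 / η₀) := by
    refine lt_min (by linarith) ?_
    rw [sub_pos, div_lt_one hη0]
    exact hη
  obtain ⟨N, hN⟩ := (Metric.tendsto_atTop.1 (tendsto_ratio (σ₁ b) (X.τ₀ b))) _ hε
  set N' : ℕ := max N (⌈‖X.τ₀ b‖⌉₊ + 1) with hN'
  have hN'N : N ≤ N' := le_max_left _ _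
  have hN'b : ‖X.τ₀ b‖ < N' := by
    have h1 : ‖X.τ₀ b‖ ≤ ⌈‖X.τ₀ b‖⌉₊ := Nat.le_ceil _
    have h2 : (⌈‖X.τ₀ b‖⌉₊ + 1 : ℕ) ≤ N' := le_max_right _ _
    have h3 : ((⌈‖X.τ₀ b‖⌉₊ + 1 : ℕ) : ℝ) ≤ N' := by exact_mod_cast h2
    push_cast at h3
    linarith
  have hpos : ∀ n : ℕ, N' ≤ n → 0 < ‖(n : ℂ) + X.τ₀ b‖ := fun n hn =>
    norm_natCast_add_pos (lt_of_lt_of_le hN'b (by exact_mod_cast hn))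
  -- the slot ratios at `σ₁`
  have hr : ∀ j, 0 < 2 * X.defQuad σ₁ (xm j) / X.tauSize (xm j) := fun j => by
    have := X.tauSize_pos (hx j)
    have := X.defQuad_pos hσ₁ (hx j)
    positivity
  -- the window bounds for `n ≥ N'`
  have hwin : ∀ n : ℕ, N' ≤ n →
      1 / η₀ < ‖(n : ℂ) + σ₁ b‖ ^ 2 / ‖(n : ℂ) + X.τ₀ b‖ ^ 2 ∧
        ‖(n : ℂ) + σ₁ b‖ ^ 2 / ‖(n : ℂ) + X.τ₀ b‖ ^ 2 < η₀ := fun n hn => by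
    have hd := hN n (le_trans hN'N hn)
    rw [Real.dist_eq] at hd
    have hm1 := min_le_left (η₀ - 1) (1 - 1 / η₀)
    have hm2 := min_le_right (η₀ - 1) (1 - 1 / η₀)
    constructor
    · linarith [neg_abs_le (‖(n : ℂ) + σ₁ b‖ ^ 2 / ‖(n : ℂ) + X.τ₀ b‖ ^ 2 - 1)]
    · linarith [le_abs_self (‖(n : ℂ) + σ₁ b‖ ^ 2 / ‖(n : ℂ) + X.τ₀ b‖ ^ 2 - 1)]
  -- the scaled ratios
  have hscaled : ∀ n : ℕ, N' ≤ n → ∀ j, ∀ σ ∈ X.defEmb,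
      2 * X.defQuad σ (((n : X.E) + b) • xm j) / X.tauSize (((n : X.E) + b) • xm j) =
        (‖(n : ℂ) + σ₁ b‖ ^ 2 / ‖(n : ℂ) + X.τ₀ b‖ ^ 2) * (2 * X.defQuad σ₁ (xm j) / X.tauSize (xm j)) := by
    intro n hn j σ hσ'
    have ha0 : (n : X.E) + b ≠ 0 := by
      intro h
      have := hpos n hn
      rw [← map_natCast X.τ₀, ← map_add, h, map_zero, norm_zero] at this
      exact lt_irrefl _ this
    rw [X.ratio_smul_defEmb hdef ha0 (hx j) hσ', map_add, map_add, map_natCast, map_natCast]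
  -- suppose every scalar `n + b`, `n ∈ [N', N' + 9)`, is bad for some slot
  by_contra hall
  push Not at hall
  set s : Finset ℕ := Finset.Ico N' (N' + 9) with hs
  have hbad : ∀ n ∈ s, ∃ j : Fin 4, ∃ k : ℤ,
      (‖(n : ℂ) + σ₁ b‖ ^ 2 / ‖(n : ℂ) + X.τ₀ b‖ ^ 2) * (2 * X.defQuad σ₁ (xm j) / X.tauSize (xm j)) =
        η₀ ^ (2 * k + 1) := by
    intro n hn
    have hn' : N' ≤ n := (Finset.mem_Ico.1 hn).1
    have ha0 : (n : X.E) + b ≠ 0 := by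
      intro h
      have := hpos n hn'
      rw [← map_natCast X.τ₀, ← map_add, h, map_zero, norm_zero] at this
      exact lt_irrefl _ this
    obtain ⟨j, σ, hσ', k, hk⟩ := hall ((n : X.E) + b) ha0
    refine ⟨j, k, ?_⟩
    rw [← hscaled n hn' j σ hσ']
    exact hk
  -- the slot chosen for each bad `n`
  let f : ℕ → Fin 4 := fun n => if h : n ∈ s then Classical.choose (hbad n h) else 0
  have hf : ∀ n ∈ s, f n ∈ (Finset.univ : Finset (Fin 4)) := fun n _ => Finset.mem_univ _
  have hcard : (Finset.univ : Finset (Fin 4)).card * 2 < s.card := by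
    rw [hs, Nat.card_Ico, Finset.card_univ, Fintype.card_fin]
    omega
  obtain ⟨j, -, hj⟩ := Finset.exists_lt_card_fiber_of_mul_lt_card_of_maps_to hf hcard
  obtain ⟨n, m, l, hn, hm, hl, hnm, hnl, hml⟩ := Finset.two_lt_card_iff.1 hj
  have hspec : ∀ p ∈ s, f p = j → ∃ k : ℤ,
      (‖(p : ℂ) + σ₁ b‖ ^ 2 / ‖(p : ℂ) + X.τ₀ b‖ ^ 2) * (2 * X.defQuad σ₁ (xm j) / X.tauSize (xm j)) =
        η₀ ^ (2 * k + 1) := by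
    intro p hp hpj
    have hfp : f p = Classical.choose (hbad p hp) := by simp only [f, dif_pos hp]
    rw [hfp] at hpj
    obtain ⟨k, hk⟩ := Classical.choose_spec (hbad p hp)
    refine ⟨k, ?_⟩
    rw [← hpj]
    exact hk
  obtain ⟨hn, hnj⟩ := Finset.mem_filter.1 hn
  obtain ⟨hm, hmj⟩ := Finset.mem_filter.1 hm
  obtain ⟨hl, hlj⟩ := Finset.mem_filter.1 hl
  obtain ⟨kn, hkn⟩ := hspec n hn hnj
  obtain ⟨km, hkm⟩ := hspec m hm hmj
  obtain ⟨kl, hkl⟩ := hspec l hl hlj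
  have hn' := (Finset.mem_Ico.1 hn).1
  have hm' := (Finset.mem_Ico.1 hm).1
  have hl' := (Finset.mem_Ico.1 hl).1
  have hnm' := eq_of_mul_eq_zpow_odd hη (hr j) (hwin n hn').1 (hwin n hn').2 (hwin m hm').1 (hwin m hm').2 hkn hkm
  have hnl' := eq_of_mul_eq_zpow_odd hη (hr j) (hwin n hn').1 (hwin n hn').2 (hwin l hl').1 (hwin l hl').2 hkn hkl
  exact ratio_eq_at_most_two hb1' hb2' hnm hnl hml (hpos n hn').ne' (hpos m hm').ne' (hpos l hl').ne'
    rfl hnm'.symm hnl'.symm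

/-- **C-L3-HODD WITH THE CENTRE CLAUSES**: from a symmetric `J`-positive centre with wedge `≠ 0` and `gram 0 1 ≠ 0`, the
common scalar `λ` of `exists_scalar_hodd` gives the centre `xm'' j = λ • xm j` with the same four clauses (WindowCentre
`wedge_scaled_ne` / `jpos_scaled` / `gram_scaled_ne`) and no slot ratio an odd power of `η₀`. -/
theorem exists_scaled_centre_hodd (hQ : X.QuarticShape) {η₀ : ℝ} (hη : 1 < η₀)
    {xm : X.Tuple} (h02 : xm 2 = xm 0) (h13 : xm 3 = xm 1)
    (hab : X.ballCoord (xm 0) 0 * X.ballCoord (xm 1) 1 - X.ballCoord (xm 0) 1 * X.ballCoord (xm 1) 0 ≠ 0)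
    (hpos : ∀ u v : ℂ, (u ≠ 0 ∨ v ≠ 0) →
      0 < (star (u • X.ballCoord (xm 0) + v • X.ballCoord (xm 1)) ⬝ᵥ
        (J *ᵥ (u • X.ballCoord (xm 0) + v • X.ballCoord (xm 1)))).re)
    (hB : X.gram xm 0 1 ≠ 0) :
    ∃ (lam : X.E) (xm'' : X.Tuple), lam ≠ 0 ∧ (∀ j, xm'' j = lam • xm j) ∧
      xm'' 2 = xm'' 0 ∧ xm'' 3 = xm'' 1 ∧
      X.ballCoord (xm'' 0) 0 * X.ballCoord (xm'' 1) 1 - X.ballCoord (xm'' 0) 1 * X.ballCoord (xm'' 1) 0 ≠ 0 ∧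
      (∀ u v : ℂ, (u ≠ 0 ∨ v ≠ 0) →
        0 < (star (u • X.ballCoord (xm'' 0) + v • X.ballCoord (xm'' 1)) ⬝ᵥ
          (J *ᵥ (u • X.ballCoord (xm'' 0) + v • X.ballCoord (xm'' 1)))).re) ∧
      X.gram xm'' 0 1 ≠ 0 ∧
      ∀ j, ∀ σ ∈ X.defEmb, ∀ k : ℤ,
        2 * X.defQuad σ (xm'' j) / X.tauSize (xm'' j) ≠ η₀ ^ (2 * k + 1) := by
  have hx : ∀ j, xm j ≠ 0 := by
    have h0 : xm 0 ≠ 0 := X.ne_zero_of_wedge hab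
    have h1 : xm 1 ≠ 0 := X.slot1_ne_zero_of_wedge hab
    intro j
    match j with
    | 0 => exact h0
    | 1 => exact h1
    | 2 => rw [h02]; exact h0
    | 3 => rw [h13]; exact h1
  obtain ⟨lam, hlam, hodd⟩ := X.exists_scalar_hodd hQ hη hx
  refine ⟨lam, fun j => lam • xm j, hlam, fun j => rfl, ?_, ?_, ?_, ?_, ?_, hodd⟩
  · show lam • xm 2 = lam • xm 0
    rw [h02]
  · show lam • xm 3 = lam • xm 1
    rw [h13]
  · exact X.wedge_scaled_ne hlam hlam hab
  · exact X.jpos_scaled hlam hlam hpos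
  · exact X.gram_scaled_ne (xm := xm) hlam hlam rfl rfl hB

end T4Data

end Summit.Ventures.HodgeRepro.Tier4.Line3

end
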